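import Literature.MathematicalPhysics.QuantumLattice.HubbardDressedClusterPressureFloor
import HarnessLib

/-!
# The seam-dressed cluster floor is AFFINE IN THE COUPLINGS: coefficient form of the C3 certificate,
# one certificate ⇒ pressure floors at every `(β, t, t', U)` and on whole parameter boxes

Topic `Literature/MathematicalPhysics/QuantumLattice` (namespace = path; family `hubbard`). Sequel of
`HubbardDressedClusterEnergyFunctional.lean` (the functional `SeamDressed.boxEnergy`), `HubbardDressedClusterNode.lean`
(claim nodes `SeamDressed.Node` / `SeamDressed.FloorNode`) and `HubbardDressedClusterPressureFloor.lean` (the kernel theorem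
`(S(σ) − β·E_box)/(ab) ≤ pressureTT' β t t' U n`).

THE POINT. The dressed trial state of a C3 certificate — one box density `σ` on `[0,a) × [0,b)` and one layer of separated
number-conserving gates — does not depend on the couplings, and its energy functional is AFFINE in them:

  `E_box(σ, W; t, t', U) = U · D − t · K − t' · K'`                                    (`boxEnergy_eq_coeff`)

with `D = Σ_{x ∈ box} ⟨n_{x↑} n_{x↓}⟩` (`boxDocc`), `K = Σ_x (⟨hop⟩_{x,x+e₀} + ⟨hop⟩_{x,x+e₁})` (`boxKinetic`) and
`K' = Σ_x (⟨hop⟩_{x,x+e₀+e₁} + ⟨hop⟩_{x,x+e₀−e₁})` (`boxKineticDiag`) the dressed expectations of the SAME state, and the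
Gibbs variational functional `S(σ) − β E_box` is affine in `β`. Hence ONE certificate, read as interval enclosures of the
three coefficients (plus the entropy floor `S⁻`), is a pressure floor at EVERY inverse temperature and EVERY coupling:

* `SeamDressed.CoeffNode a b n S⁻ D⁺ K⁻ K'⁻ K'⁺` — the claim node: ∃ the witness of `SeamDressed.Node` (gates inside
  `gateRange a b`, separated, unitary, `[u_g, N] = 0`; `σ ⪰ 0`, `tr σ = 1`, `[σ, N] = 0`, `Re tr(σN) = n·ab`) with
  `S⁻ ≤ S(σ)`, `D ≤ D⁺`, `K⁻ ≤ K`, `K'⁻ ≤ K' ≤ K'⁺` (the two signs of `t'` need the two sides of `K'`);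
* `CoeffNode.node_of_tPrime_nonpos` / `…_nonneg` — for `t ≥ 0`, `U ≥ 0` and `t' ≤ 0` (resp. `t' ≥ 0`) the node IS a
  two-number node `Node t t' U a b n S⁻ E⁺` with `E⁺ = U D⁺ − t K⁻ − t' K'⁺` (resp. `− t' K'⁻`); hence
  `CoeffNode.floorNode_…`, `le_pressureTT'_of_coeffNode_…` (`W₀·ab ≤ S⁻ − β E⁺ ⇒ W₀ ≤ pressureTT' β t t' U n`) and the
  torus-sequence shape `eventually_floor_of_coeffNode_…` by the theorems of the two prequels — no new analysis;
* BOX WORDS: `S⁻ − β (U D⁺ − t K⁻ − t' K'⁺)` is affine in each of `β`, `t'`, `U` separately, so on a box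
  `[β₁,β₂] × [t'₁,t'₂] × [U₁,U₂]` it is bounded below by its minimum over the EIGHT CORNERS
  (`le_pressureTT'_on_box_of_coeffNode_of_tPrime_nonpos`: eight `norm_num` inequalities ⇒ `W₀ ≤ pressureTT' β t t' U n` on
  the whole box); the `β`-interval version for a two-number node is `le_pressureTT'_on_betaIcc_of_node`.

WHY (the cell's currency). The tree transports a cold pressure floor along `t'` only at the KINEMATIC price
`β |Δt'| · 16/π²` per site (`HubbardTTPrimeDiagHopTransportThermal`, `TypeClassSidecarReaderTPrimeTransport`): at `β = 4`,
`|Δt'| = 1/40` that is `0.162`, more than the whole gain of the C3 floor over the zero-entropy floor at `(8, 7/8, −1/4)`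
(`+0.103`). The coefficient node transports the same floor at the trial state's OWN diagonal kinetic density
`β |Δt'| · |K'|/(ab)` (an order of magnitude smaller), moves it UP in `U` at `β ΔU · D⁺/(ab)` (down in `U` the tree's
monotonicity is free), and along `β` at `|Δβ| · |E⁺|/(ab)` — exactly what the true pressure does to first order, since the
equilibrium state's own coefficients are the derivatives of the (convex-in-the-interaction) pressure.
[cite: Israel1979, §II.1 eq. (1)–(2)]

Definitions (three real-valued coefficient functionals with bodies, one `Prop`-valued claim node) and proved theorems;
no named fact. HONEST SCOPE: like `boxEnergy`, the coefficients are finite sums of traces of `4^{|Λ(S)|}`-dimensional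
matrices, certified numerically off-kernel (interval arithmetic: the producer prints the enclosures of `D, K, K'` next to
`S⁻`) and consumed through the claim node; the kernel proves only what follows from the enclosures.

## References

* R. B. Israel, *Convexity in the Theory of Lattice Gases* (1979), §II.1 (the pressure as a convex function of the
  interaction; trial functionals affine in the interaction). [cite: Israel1979, §II.1 eq. (1)–(2)]
* R. B. Israel, op. cit., Lemma II.3.1 (Gibbs variational bound). [cite: Israel1979, Lemma II.3.1]
* M. Kliesch, C. Gogolin, M. J. Kastoryano, A. Riera, J. Eisert, Phys. Rev. X 4 (2014) 031019, §II. [cite: KlieschEtAl2014, §II]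
* D. Ruelle, *Statistical Mechanics: Rigorous Results* (1969), §3.4. [cite: Ruelle1969, §3.4]

## Tree / Mathlib search

REUSED: `SeamDressed.boxEnergy`, `locE`, `onsitePair`, `hop`, `gateRange`, `rectWindow` (`HubbardDressedClusterEnergyFunctional`,
`…TorusGeometry`), `SeamDressed.Node`, `FloorNode`, `floorNode_of_node` (`HubbardDressedClusterNode`),
`le_pressureTT'_of_node`, `le_pressureTT'_of_floorNode`, `eventually_floor_of_floorNode` (`HubbardDressedClusterPressureFloor`),
`parityAut_eq_self_of_commute_totalNumber`. `lean search 'CoeffNode|boxDocc|boxKinetic'`: nothing (2026-08-27).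
-/

noncomputable section

namespace Literature.MathematicalPhysics.QuantumLattice

open Matrix Finset HubbardWave0 Literature.Probability.LatticeModels AndersonCluster ThermodynamicLimit LiebThm1
open _root_.Filter
open scoped _root_.Topology ComplexOrder BigOperators
open Literature.InformationTheory.Entropy (vonNeumannEntropy)

namespace SeamDressed

/-! ### §1. The three coupling coefficients of the dressed box energy -/

section Coefficients

variable (a b : ℕ) [NeZero a] [NeZero b] {m : ℕ} (G : Fin m → Finset (Site 2))
  (hsep : ∀ g g', ∀ x ∈ G g, ∀ x' ∈ G g', ((a : ℤ) ∣ x' 0 - x 0) → ((b : ℤ) ∣ x' 1 - x 1) → g = g' ∧ x = x')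
  (u : ∀ g, FermionOp (G g)) (hu : ∀ g, parityAut (u g) = u g)
  (σ : FermionOp (rectWindow a b)) (hσ : parityAut σ = σ)

/-- **The dressed double occupancy of the box** `D = Σ_{x ∈ [0,a)×[0,b)} ⟨n_{x↑} n_{x↓}⟩_{{x}}` (the `U`-coefficient of
`boxEnergy`). [cite: KlieschEtAl2014, §II] -/
def boxDocc : ℝ :=
  ∑ x ∈ rectWindow a b, locE a b G hsep u hu σ hσ {x} (onsitePair x)

/-- **The dressed nearest-neighbour kinetic sum of the box** `K = Σ_{x ∈ box} (⟨hop⟩_{{x,x+e₀}} + ⟨hop⟩_{{x,x+e₁}})`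
(forward bonds; `−t·K` is the `t`-part of `boxEnergy`). [cite: KlieschEtAl2014, §II] -/
def boxKinetic : ℝ :=
  ∑ x ∈ rectWindow a b,
    (locE a b G hsep u hu σ hσ {x, x + unitVec 0} (hop x (x + unitVec 0))
      + locE a b G hsep u hu σ hσ {x, x + unitVec 1} (hop x (x + unitVec 1)))

/-- **The dressed diagonal (next-nearest-neighbour) kinetic sum of the box**
`K' = Σ_{x ∈ box} (⟨hop⟩_{{x,x+e₀+e₁}} + ⟨hop⟩_{{x,x+e₀−e₁}})` (`−t'·K'` is the `t'`-part of `boxEnergy`).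
[cite: KlieschEtAl2014, §II] -/
def boxKineticDiag : ℝ :=
  ∑ x ∈ rectWindow a b,
    (locE a b G hsep u hu σ hσ {x, x + unitVec 0 + unitVec 1} (hop x (x + unitVec 0 + unitVec 1))
      + locE a b G hsep u hu σ hσ {x, x + unitVec 0 - unitVec 1} (hop x (x + unitVec 0 - unitVec 1)))

/-- **The dressed box energy is affine in the couplings**: `E_box(t, t', U) = U·D − t·K − t'·K'` for the SAME dressed
trial state. [cite: Israel1979, §II.1 eq. (1)–(2)] -/
theorem boxEnergy_eq_coeff (t t' U : ℝ) :
    boxEnergy a b G hsep u hu σ hσ t t' U =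
      U * boxDocc a b G hsep u hu σ hσ - t * boxKinetic a b G hsep u hu σ hσ - t' * boxKineticDiag a b G hsep u hu σ hσ := by
  simp only [boxEnergy, boxDocc, boxKinetic, boxKineticDiag, Finset.mul_sum, ← Finset.sum_sub_distrib]

/-- **Change of couplings for one trial state**: `E_box(t₂, t'₂, U₂) = E_box(t₁, t'₁, U₁) + (U₂ − U₁) D − (t₂ − t₁) K −
(t'₂ − t'₁) K'`. [cite: Israel1979, §II.1 eq. (1)–(2)] -/
theorem boxEnergy_sub_boxEnergy (t₁ t'₁ U₁ t₂ t'₂ U₂ : ℝ) :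
    boxEnergy a b G hsep u hu σ hσ t₂ t'₂ U₂ - boxEnergy a b G hsep u hu σ hσ t₁ t'₁ U₁ =
      (U₂ - U₁) * boxDocc a b G hsep u hu σ hσ - (t₂ - t₁) * boxKinetic a b G hsep u hu σ hσ
        - (t'₂ - t'₁) * boxKineticDiag a b G hsep u hu σ hσ := by
  rw [boxEnergy_eq_coeff, boxEnergy_eq_coeff]
  ring

/-- **One-sided coupling bound, `t' ≤ 0`**: from `D ≤ D⁺`, `K⁻ ≤ K`, `K' ≤ K'⁺` and `t ≥ 0`, `t' ≤ 0`, `U ≥ 0`: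
`E_box(t, t', U) ≤ U D⁺ − t K⁻ − t' K'⁺`. [cite: Israel1979, §II.1 eq. (1)–(2)] -/
theorem boxEnergy_le_of_coeff_bounds_of_tPrime_nonpos {t t' U Dhi Klo Ghi : ℝ} (ht : 0 ≤ t) (ht' : t' ≤ 0)
    (hU : 0 ≤ U) (hD : boxDocc a b G hsep u hu σ hσ ≤ Dhi) (hK : Klo ≤ boxKinetic a b G hsep u hu σ hσ)
    (hG : boxKineticDiag a b G hsep u hu σ hσ ≤ Ghi) :
    boxEnergy a b G hsep u hu σ hσ t t' U ≤ U * Dhi - t * Klo - t' * Ghi := by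
  rw [boxEnergy_eq_coeff]
  nlinarith [mul_le_mul_of_nonneg_left hD hU, mul_le_mul_of_nonneg_left hK ht,
    mul_le_mul_of_nonneg_left hG (neg_nonneg.2 ht')]

/-- **One-sided coupling bound, `t' ≥ 0`**: from `D ≤ D⁺`, `K⁻ ≤ K`, `K'⁻ ≤ K'` and `t ≥ 0`, `t' ≥ 0`, `U ≥ 0`:
`E_box(t, t', U) ≤ U D⁺ − t K⁻ − t' K'⁻`. [cite: Israel1979, §II.1 eq. (1)–(2)] -/
theorem boxEnergy_le_of_coeff_bounds_of_tPrime_nonneg {t t' U Dhi Klo Glo : ℝ} (ht : 0 ≤ t) (ht' : 0 ≤ t')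
    (hU : 0 ≤ U) (hD : boxDocc a b G hsep u hu σ hσ ≤ Dhi) (hK : Klo ≤ boxKinetic a b G hsep u hu σ hσ)
    (hG : Glo ≤ boxKineticDiag a b G hsep u hu σ hσ) :
    boxEnergy a b G hsep u hu σ hσ t t' U ≤ U * Dhi - t * Klo - t' * Glo := by
  rw [boxEnergy_eq_coeff]
  nlinarith [mul_le_mul_of_nonneg_left hD hU, mul_le_mul_of_nonneg_left hK ht, mul_le_mul_of_nonneg_left hG ht']

end Coefficients

/-! ### §2. The coefficient claim node and its reduction to the two-number node -/

section Node

/-- **C3 claim node, coefficient form.** The witness of `SeamDressed.Node` (gates `G, u` inside `gateRange a b`, separated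
modulo the box lattice, unitary, particle-number conserving; box state `σ ⪰ 0`, `tr σ = 1`, `[σ, N] = 0`,
`Re tr(σN) = n·ab`) with interval-certified `S⁻ ≤ S(σ)`, `D ≤ D⁺`, `K⁻ ≤ K`, `K'⁻ ≤ K' ≤ K'⁺` — a statement about the
trial state alone, independent of `(β, t, t', U)`. [cite: KlieschEtAl2014, §II] [cite: Israel1979, §II.1 eq. (1)–(2)] -/
def CoeffNode (a b : ℕ) [NeZero a] [NeZero b] (n Slo Dhi Klo Glo Ghi : ℝ) : Prop :=
  ∃ (m : ℕ) (G : Fin m → Finset (Site 2))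
    (hsep : ∀ g g', ∀ x ∈ G g, ∀ x' ∈ G g', ((a : ℤ) ∣ x' 0 - x 0) → ((b : ℤ) ∣ x' 1 - x 1) → g = g' ∧ x = x')
    (u : ∀ g, FermionOp (G g)) (huN : ∀ g, Commute (totalNumber : FermionOp (G g)) (u g))
    (σ : FermionOp (rectWindow a b)) (hσN : Commute (totalNumber : FermionOp (rectWindow a b)) σ),
    (∀ g, G g ⊆ gateRange a b) ∧ (∀ g, (u g)ᴴ * u g = 1) ∧ σ.PosSemidef ∧ σ.trace = 1 ∧
      (σ * (totalNumber : FermionOp (rectWindow a b))).trace.re = n * (a * b) ∧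
      Slo ≤ vonNeumannEntropy σ ∧
      boxDocc a b G hsep u (fun g => parityAut_eq_self_of_commute_totalNumber (huN g)) σ
          (parityAut_eq_self_of_commute_totalNumber hσN) ≤ Dhi ∧
      Klo ≤ boxKinetic a b G hsep u (fun g => parityAut_eq_self_of_commute_totalNumber (huN g)) σ
          (parityAut_eq_self_of_commute_totalNumber hσN) ∧
      Glo ≤ boxKineticDiag a b G hsep u (fun g => parityAut_eq_self_of_commute_totalNumber (huN g)) σ
          (parityAut_eq_self_of_commute_totalNumber hσN) ∧
      boxKineticDiag a b G hsep u (fun g => parityAut_eq_self_of_commute_totalNumber (huN g)) σ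
          (parityAut_eq_self_of_commute_totalNumber hσN) ≤ Ghi

variable {a b : ℕ} [NeZero a] [NeZero b] {n Slo Dhi Klo Glo Ghi : ℝ}

/-- **Coefficient node ⇒ two-number node, `t' ≤ 0`** (the hole-doped sign): for `t ≥ 0`, `t' ≤ 0`, `U ≥ 0` the same
witness is a `Node t t' U a b n S⁻ (U D⁺ − t K⁻ − t' K'⁺)`. [cite: Israel1979, §II.1 eq. (1)–(2)] -/
theorem CoeffNode.node_of_tPrime_nonpos (h : CoeffNode a b n Slo Dhi Klo Glo Ghi) {t t' U : ℝ} (ht : 0 ≤ t)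
    (ht' : t' ≤ 0) (hU : 0 ≤ U) : Node t t' U a b n Slo (U * Dhi - t * Klo - t' * Ghi) := by
  obtain ⟨m, G, hsep, u, huN, σ, hσN, hG, huU, hσ, hσtr, hσn, hS, hD, hK, -, hGhi⟩ := h
  exact ⟨m, G, hsep, u, huN, σ, hσN, hG, huU, hσ, hσtr, hσn, hS,
    boxEnergy_le_of_coeff_bounds_of_tPrime_nonpos a b G hsep u _ σ _ ht ht' hU hD hK hGhi⟩

/-- **Coefficient node ⇒ two-number node, `t' ≥ 0`**: for `t ≥ 0`, `t' ≥ 0`, `U ≥ 0` the same witness is a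
`Node t t' U a b n S⁻ (U D⁺ − t K⁻ − t' K'⁻)`. [cite: Israel1979, §II.1 eq. (1)–(2)] -/
theorem CoeffNode.node_of_tPrime_nonneg (h : CoeffNode a b n Slo Dhi Klo Glo Ghi) {t t' U : ℝ} (ht : 0 ≤ t)
    (ht' : 0 ≤ t') (hU : 0 ≤ U) : Node t t' U a b n Slo (U * Dhi - t * Klo - t' * Glo) := by
  obtain ⟨m, G, hsep, u, huN, σ, hσN, hG, huU, hσ, hσtr, hσn, hS, hD, hK, hGlo, -⟩ := h
  exact ⟨m, G, hsep, u, huN, σ, hσN, hG, huU, hσ, hσtr, hσn, hS,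
    boxEnergy_le_of_coeff_bounds_of_tPrime_nonneg a b G hsep u _ σ _ ht ht' hU hD hK hGlo⟩

/-- **Coefficient node ⇒ floor node, `t' ≤ 0`**: with `β ≥ 0` and the certified arithmetic
`W₀·ab ≤ S⁻ − β (U D⁺ − t K⁻ − t' K'⁺)`. [cite: Israel1979, Lemma II.3.1] -/
theorem CoeffNode.floorNode_of_tPrime_nonpos (h : CoeffNode a b n Slo Dhi Klo Glo Ghi) {t t' U β W0 : ℝ}
    (ht : 0 ≤ t) (ht' : t' ≤ 0) (hU : 0 ≤ U) (hβ : 0 ≤ β)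
    (harith : W0 * (a * b) ≤ Slo - β * (U * Dhi - t * Klo - t' * Ghi)) : FloorNode t t' U a b n β W0 :=
  floorNode_of_node (h.node_of_tPrime_nonpos ht ht' hU) hβ harith

/-- **Coefficient node ⇒ floor node, `t' ≥ 0`**: with `β ≥ 0` and `W₀·ab ≤ S⁻ − β (U D⁺ − t K⁻ − t' K'⁻)`.
[cite: Israel1979, Lemma II.3.1] -/
theorem CoeffNode.floorNode_of_tPrime_nonneg (h : CoeffNode a b n Slo Dhi Klo Glo Ghi) {t t' U β W0 : ℝ}
    (ht : 0 ≤ t) (ht' : 0 ≤ t') (hU : 0 ≤ U) (hβ : 0 ≤ β)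
    (harith : W0 * (a * b) ≤ Slo - β * (U * Dhi - t * Klo - t' * Glo)) : FloorNode t t' U a b n β W0 :=
  floorNode_of_node (h.node_of_tPrime_nonneg ht ht' hU) hβ harith

end Node

/-! ### §3. Pressure floors at every `(β, t, t', U)` from one coefficient node -/

section Floor

variable {a b : ℕ} [NeZero a] [NeZero b] {n Slo Dhi Klo Glo Ghi : ℝ}

/-- **THE COEFFICIENT-NODE PRESSURE FLOOR, `t' ≤ 0`.** `CoeffNode a b n S⁻ D⁺ K⁻ K'⁻ K'⁺`, `β > 0`, `t ≥ 0`, `t' ≤ 0`,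
`U ≥ 0`, `0 < n < 2` and the certified arithmetic `W₀·ab ≤ S⁻ − β (U D⁺ − t K⁻ − t' K'⁺)` give
`W₀ ≤ pressureTT' β t t' U n`. [cite: Ruelle1969, §3.4] [cite: Israel1979, Lemma II.3.1] -/
theorem le_pressureTT'_of_coeffNode_of_tPrime_nonpos (h : CoeffNode a b n Slo Dhi Klo Glo Ghi) {β t t' U W0 : ℝ}
    (hβ : 0 < β) (ht : 0 ≤ t) (ht' : t' ≤ 0) (hU : 0 ≤ U) (hn0 : 0 < n) (hn2 : n < 2)
    (harith : W0 * (a * b) ≤ Slo - β * (U * Dhi - t * Klo - t' * Ghi)) : W0 ≤ pressureTT' β t t' U n :=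
  le_pressureTT'_of_node hβ hU hn0 hn2 (h.node_of_tPrime_nonpos ht ht' hU) harith

/-- **THE COEFFICIENT-NODE PRESSURE FLOOR, `t' ≥ 0`.** Same with `W₀·ab ≤ S⁻ − β (U D⁺ − t K⁻ − t' K'⁻)`.
[cite: Ruelle1969, §3.4] [cite: Israel1979, Lemma II.3.1] -/
theorem le_pressureTT'_of_coeffNode_of_tPrime_nonneg (h : CoeffNode a b n Slo Dhi Klo Glo Ghi) {β t t' U W0 : ℝ}
    (hβ : 0 < β) (ht : 0 ≤ t) (ht' : 0 ≤ t') (hU : 0 ≤ U) (hn0 : 0 < n) (hn2 : n < 2)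
    (harith : W0 * (a * b) ≤ Slo - β * (U * Dhi - t * Klo - t' * Glo)) : W0 ≤ pressureTT' β t t' U n :=
  le_pressureTT'_of_node hβ hU hn0 hn2 (h.node_of_tPrime_nonneg ht ht' hU) harith

/-- **The coefficient-node floor along every sequence of tori, `t' ≤ 0`** (the `hW` shape of the torus-limit readers and
of the `U`/`t'`-face words): `∀ ε > 0, ∀ᶠ j, (W₀ − ε)(Ls j)² ≤ log Re Z_β(H^{TT'}_{n, Ls j})`. [cite: Israel1979, Thm. I.2.4] -/
theorem eventually_floor_of_coeffNode_of_tPrime_nonpos (h : CoeffNode a b n Slo Dhi Klo Glo Ghi) {β t t' U W0 : ℝ}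
    (hβ : 0 < β) (ht : 0 ≤ t) (ht' : t' ≤ 0) (hU : 0 ≤ U) (hn0 : 0 < n) (hn2 : n < 2)
    (harith : W0 * (a * b) ≤ Slo - β * (U * Dhi - t * Klo - t' * Ghi)) {Ls : ℕ → ℕ} (hLs : Tendsto Ls atTop atTop)
    {ε : ℝ} (hε : 0 < ε) :
    ∀ᶠ j in atTop, (W0 - ε) * (Ls j : ℝ) ^ 2 ≤ Real.log (partitionFn β (sectorHamiltonianTT' t t' U n (Ls j))).re :=
  eventually_floor_of_floorNode hβ hU hn0 hn2 (h.floorNode_of_tPrime_nonpos ht ht' hU hβ.le harith) hLs hε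

/-- **The coefficient-node floor along every sequence of tori, `t' ≥ 0`.** [cite: Israel1979, Thm. I.2.4] -/
theorem eventually_floor_of_coeffNode_of_tPrime_nonneg (h : CoeffNode a b n Slo Dhi Klo Glo Ghi) {β t t' U W0 : ℝ}
    (hβ : 0 < β) (ht : 0 ≤ t) (ht' : 0 ≤ t') (hU : 0 ≤ U) (hn0 : 0 < n) (hn2 : n < 2)
    (harith : W0 * (a * b) ≤ Slo - β * (U * Dhi - t * Klo - t' * Glo)) {Ls : ℕ → ℕ} (hLs : Tendsto Ls atTop atTop)
    {ε : ℝ} (hε : 0 < ε) :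
    ∀ᶠ j in atTop, (W0 - ε) * (Ls j : ℝ) ^ 2 ≤ Real.log (partitionFn β (sectorHamiltonianTT' t t' U n (Ls j))).re :=
  eventually_floor_of_floorNode hβ hU hn0 hn2 (h.floorNode_of_tPrime_nonneg ht ht' hU hβ.le harith) hLs hε

end Floor

/-! ### §4. Box words: an affine function on a box is bounded below by its corners -/

section Box

/-- **Affine in one variable: two endpoints control the interval.** If `c ≤ p + q x₁` and `c ≤ p + q x₂` then
`c ≤ p + q x` for every `x ∈ [x₁, x₂]`. [cite: Israel1979, §II.1 eq. (1)–(2)] -/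
theorem le_affine_of_le_endpoints {p q x₁ x₂ x c : ℝ} (hx : x ∈ Set.Icc x₁ x₂) (h₁ : c ≤ p + q * x₁)
    (h₂ : c ≤ p + q * x₂) : c ≤ p + q * x := by
  obtain ⟨hx₁, hx₂⟩ := hx
  by_cases hq : 0 ≤ q
  · nlinarith [mul_le_mul_of_nonneg_left hx₁ hq]
  · nlinarith [mul_le_mul_of_nonpos_left hx₂ (le_of_lt (not_le.1 hq))]

variable {a b : ℕ} [NeZero a] [NeZero b] {n Slo Dhi Klo Glo Ghi : ℝ}

omit [NeZero a] [NeZero b] in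
/-- **The certified arithmetic on a box from its eight corners.** The function
`(β, s, U) ↦ S⁻ − β (U D⁺ − t K⁻ − s G)` (`G` = either side of `K'`) is affine in each variable separately, so if `W₀·ab` is below it at the eight
corners of `[β₁,β₂] × [s₁,s₂] × [U₁,U₂]` it is below it on the whole box. [cite: Israel1979, §II.1 eq. (1)–(2)] -/
theorem arith_on_box_of_corners {t β₁ β₂ s₁ s₂ U₁ U₂ W0 : ℝ}
    (h₁₁₁ : W0 * (a * b) ≤ Slo - β₁ * (U₁ * Dhi - t * Klo - s₁ * Ghi))
    (h₁₁₂ : W0 * (a * b) ≤ Slo - β₁ * (U₂ * Dhi - t * Klo - s₁ * Ghi))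
    (h₁₂₁ : W0 * (a * b) ≤ Slo - β₁ * (U₁ * Dhi - t * Klo - s₂ * Ghi))
    (h₁₂₂ : W0 * (a * b) ≤ Slo - β₁ * (U₂ * Dhi - t * Klo - s₂ * Ghi))
    (h₂₁₁ : W0 * (a * b) ≤ Slo - β₂ * (U₁ * Dhi - t * Klo - s₁ * Ghi))
    (h₂₁₂ : W0 * (a * b) ≤ Slo - β₂ * (U₂ * Dhi - t * Klo - s₁ * Ghi))
    (h₂₂₁ : W0 * (a * b) ≤ Slo - β₂ * (U₁ * Dhi - t * Klo - s₂ * Ghi))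
    (h₂₂₂ : W0 * (a * b) ≤ Slo - β₂ * (U₂ * Dhi - t * Klo - s₂ * Ghi))
    {β s U : ℝ} (hβ : β ∈ Set.Icc β₁ β₂) (hs : s ∈ Set.Icc s₁ s₂) (hU : U ∈ Set.Icc U₁ U₂) :
    W0 * (a * b) ≤ Slo - β * (U * Dhi - t * Klo - s * Ghi) := by
  -- β-direction at the four `(s, U)` corners: `S⁻ − β E = S⁻ + (−E)·β`
  have c₁₁ : W0 * (a * b) ≤ Slo + (-(U₁ * Dhi - t * Klo - s₁ * Ghi)) * β :=
    le_affine_of_le_endpoints hβ (by linarith) (by linarith)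
  have c₁₂ : W0 * (a * b) ≤ Slo + (-(U₂ * Dhi - t * Klo - s₁ * Ghi)) * β :=
    le_affine_of_le_endpoints hβ (by linarith) (by linarith)
  have c₂₁ : W0 * (a * b) ≤ Slo + (-(U₁ * Dhi - t * Klo - s₂ * Ghi)) * β :=
    le_affine_of_le_endpoints hβ (by linarith) (by linarith)
  have c₂₂ : W0 * (a * b) ≤ Slo + (-(U₂ * Dhi - t * Klo - s₂ * Ghi)) * β :=
    le_affine_of_le_endpoints hβ (by linarith) (by linarith)
  -- s-direction at the two `U` corners: `… = (S⁻ − β U D⁺ + β t K⁻) + (β K'⁺)·s`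
  have d₁ : W0 * (a * b) ≤ (Slo - β * (U₁ * Dhi) + β * (t * Klo)) + (β * Ghi) * s :=
    le_affine_of_le_endpoints hs (by linarith) (by linarith)
  have d₂ : W0 * (a * b) ≤ (Slo - β * (U₂ * Dhi) + β * (t * Klo)) + (β * Ghi) * s :=
    le_affine_of_le_endpoints hs (by linarith) (by linarith)
  -- U-direction: `… = (S⁻ + β t K⁻ + β s K'⁺) + (−β D⁺)·U`
  have e : W0 * (a * b) ≤ (Slo + β * (t * Klo) + β * Ghi * s) + (-(β * Dhi)) * U :=
    le_affine_of_le_endpoints hU (by linarith) (by linarith)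
  linarith

/-- **BOX WORD FROM ONE COEFFICIENT NODE (`t' ≤ 0`, the hole-doped side).** `CoeffNode a b n S⁻ D⁺ K⁻ K'⁻ K'⁺`, `t ≥ 0`,
`0 < n < 2`, a box `[β₁,β₂] × [s₁,s₂] × [U₁,U₂]` with `β₁ > 0`, `s₂ ≤ 0`, `U₁ ≥ 0`, and the eight corner inequalities
`W₀·ab ≤ S⁻ − β_i (U_k D⁺ − t K⁻ − s_j K'⁺)` give `W₀ ≤ pressureTT' β t s U n` for EVERY `(β, s, U)` in the box — one
certificate, one trial state, the whole parameter box. [cite: Ruelle1969, §3.4] [cite: Israel1979, §II.1 eq. (1)–(2)] -/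
theorem le_pressureTT'_on_box_of_coeffNode_of_tPrime_nonpos (h : CoeffNode a b n Slo Dhi Klo Glo Ghi) (hn0 : 0 < n)
    (hn2 : n < 2) {t β₁ β₂ s₁ s₂ U₁ U₂ W0 : ℝ} (ht : 0 ≤ t) (hβ₁ : 0 < β₁) (hs₂ : s₂ ≤ 0) (hU₁ : 0 ≤ U₁)
    (h₁₁₁ : W0 * (a * b) ≤ Slo - β₁ * (U₁ * Dhi - t * Klo - s₁ * Ghi))
    (h₁₁₂ : W0 * (a * b) ≤ Slo - β₁ * (U₂ * Dhi - t * Klo - s₁ * Ghi))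
    (h₁₂₁ : W0 * (a * b) ≤ Slo - β₁ * (U₁ * Dhi - t * Klo - s₂ * Ghi))
    (h₁₂₂ : W0 * (a * b) ≤ Slo - β₁ * (U₂ * Dhi - t * Klo - s₂ * Ghi))
    (h₂₁₁ : W0 * (a * b) ≤ Slo - β₂ * (U₁ * Dhi - t * Klo - s₁ * Ghi))
    (h₂₁₂ : W0 * (a * b) ≤ Slo - β₂ * (U₂ * Dhi - t * Klo - s₁ * Ghi))
    (h₂₂₁ : W0 * (a * b) ≤ Slo - β₂ * (U₁ * Dhi - t * Klo - s₂ * Ghi))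
    (h₂₂₂ : W0 * (a * b) ≤ Slo - β₂ * (U₂ * Dhi - t * Klo - s₂ * Ghi))
    {β s U : ℝ} (hβ : β ∈ Set.Icc β₁ β₂) (hs : s ∈ Set.Icc s₁ s₂) (hU : U ∈ Set.Icc U₁ U₂) :
    W0 ≤ pressureTT' β t s U n :=
  le_pressureTT'_of_coeffNode_of_tPrime_nonpos h (lt_of_lt_of_le hβ₁ hβ.1) ht (le_trans hs.2 hs₂) (le_trans hU₁ hU.1)
    hn0 hn2 (arith_on_box_of_corners h₁₁₁ h₁₁₂ h₁₂₁ h₁₂₂ h₂₁₁ h₂₁₂ h₂₂₁ h₂₂₂ hβ hs hU)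

/-- **BOX WORD FROM ONE COEFFICIENT NODE (`t' ≥ 0`).** The same over a box `[β₁,β₂] × [s₁,s₂] × [U₁,U₂]` with
`s₁ ≥ 0`, the corner inequalities now reading `W₀·ab ≤ S⁻ − β_i (U_k D⁺ − t K⁻ − s_j K'⁻)`.
[cite: Ruelle1969, §3.4] [cite: Israel1979, §II.1 eq. (1)–(2)] -/
theorem le_pressureTT'_on_box_of_coeffNode_of_tPrime_nonneg (h : CoeffNode a b n Slo Dhi Klo Glo Ghi) (hn0 : 0 < n)
    (hn2 : n < 2) {t β₁ β₂ s₁ s₂ U₁ U₂ W0 : ℝ} (ht : 0 ≤ t) (hβ₁ : 0 < β₁) (hs₁ : 0 ≤ s₁) (hU₁ : 0 ≤ U₁)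
    (h₁₁₁ : W0 * (a * b) ≤ Slo - β₁ * (U₁ * Dhi - t * Klo - s₁ * Glo))
    (h₁₁₂ : W0 * (a * b) ≤ Slo - β₁ * (U₂ * Dhi - t * Klo - s₁ * Glo))
    (h₁₂₁ : W0 * (a * b) ≤ Slo - β₁ * (U₁ * Dhi - t * Klo - s₂ * Glo))
    (h₁₂₂ : W0 * (a * b) ≤ Slo - β₁ * (U₂ * Dhi - t * Klo - s₂ * Glo))
    (h₂₁₁ : W0 * (a * b) ≤ Slo - β₂ * (U₁ * Dhi - t * Klo - s₁ * Glo))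
    (h₂₁₂ : W0 * (a * b) ≤ Slo - β₂ * (U₂ * Dhi - t * Klo - s₁ * Glo))
    (h₂₂₁ : W0 * (a * b) ≤ Slo - β₂ * (U₁ * Dhi - t * Klo - s₂ * Glo))
    (h₂₂₂ : W0 * (a * b) ≤ Slo - β₂ * (U₂ * Dhi - t * Klo - s₂ * Glo))
    {β s U : ℝ} (hβ : β ∈ Set.Icc β₁ β₂) (hs : s ∈ Set.Icc s₁ s₂) (hU : U ∈ Set.Icc U₁ U₂) :
    W0 ≤ pressureTT' β t s U n :=
  le_pressureTT'_of_coeffNode_of_tPrime_nonneg h (lt_of_lt_of_le hβ₁ hβ.1) ht (le_trans hs₁ hs.1) (le_trans hU₁ hU.1)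
    hn0 hn2 (arith_on_box_of_corners (Ghi := Glo) h₁₁₁ h₁₁₂ h₁₂₁ h₁₂₂ h₂₁₁ h₂₁₂ h₂₂₁ h₂₂₂ hβ hs hU)

/-- **`β`-INTERVAL WORD FROM ONE TWO-NUMBER NODE.** `Node t t' U a b n S⁻ E⁺` (one trial state, `S⁻ ≤ S(σ)`, `E_box ≤ E⁺`),
`U ≥ 0`, `0 < n < 2`, `0 < β₁` and the two endpoint inequalities `W₀·ab ≤ S⁻ − β_i E⁺` give `W₀ ≤ pressureTT' β t t' U n`
for every `β ∈ [β₁, β₂]` (the functional is affine in `β`). [cite: Ruelle1969, §3.4] [cite: Israel1979, Lemma II.3.1] -/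
theorem le_pressureTT'_on_betaIcc_of_node {t t' U Ehi : ℝ} (h : Node t t' U a b n Slo Ehi) (hU : 0 ≤ U) (hn0 : 0 < n)
    (hn2 : n < 2) {β₁ β₂ W0 : ℝ} (hβ₁ : 0 < β₁) (h₁ : W0 * (a * b) ≤ Slo - β₁ * Ehi) (h₂ : W0 * (a * b) ≤ Slo - β₂ * Ehi)
    {β : ℝ} (hβ : β ∈ Set.Icc β₁ β₂) : W0 ≤ pressureTT' β t t' U n :=
  le_pressureTT'_of_node (lt_of_lt_of_le hβ₁ hβ.1) hU hn0 hn2 h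
    (by
      have := le_affine_of_le_endpoints (p := Slo) (q := -Ehi) (c := W0 * (a * b)) hβ (by linarith) (by linarith)
      linarith)

end Box

end SeamDressed

end Literature.MathematicalPhysics.QuantumLattice

end
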